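import Literature.NumberTheory.EllipticCurves.CuspFormTwist
import Literature.NumberTheory.EllipticCurves.AtkinLehnerInvolutionsProofs
import HarnessLib

/-!
# The Atkin–Lehner involution `w_{p²}` on quadratic twists (Atkin–Lehner 1970, §6; Atkin–Li 1978)

Let `p` be a prime, `M ≥ 1` with `p ∤ M`, `f ∈ S_k(Γ₀(N))` with `N ∣ Mp` (so at `p` the level of `f`
divides `p`), and `χ` a quadratic Dirichlet character mod `p`. The twist
`f_χ = g(χ)⁻¹ ∑_{u mod p} χ(u) f(τ + u/p) ∈ S_k(Γ₀(Mp²))` (`charTwist`, file `CuspFormTwist`; Shimura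
1971, Prop. 3.64) is an **eigenvector of the Atkin–Lehner involution `w_{p²}` of level `Mp²`, with
eigenvalue `χ(−1)`**:

`w_{p²} f_χ = χ(−1) f_χ`   (`atkinLehnerInvolution_charTwist`, `atkinLehnerInvolutionAt_charTwist`,
`atkinLehnerEigenvalueAt_charTwist`).

This is the case "`F` of level prime to `q` or exactly divisible by `q`, trivial character, `χ`
quadratic of conductor `q`" of the computation of the action of `W`-operators on twists
(Atkin–Lehner 1970, §6; Atkin–Li 1978, §3, where for general `χ` only a *pseudo*-eigenvalue
appears — for quadratic `χ` it is the genuine eigenvalue `χ(−1)`), and it is the modular-form side of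
Rohrlich's value `W_p = (−1/p)` of the local root number at `p ≥ 5` of an elliptic curve over `ℚ`
with additive, potentially multiplicative reduction or potentially good reduction with `e = 2` at `p`
— exactly the quadratic twists by `ℚ(√±p)` of curves semistable at `p` (Rohrlich 1993, Prop. 2).

## Proof

With `w(p²) = β diag(p², 1) = (p²x, y; Mp², p²)`, `p²x − My = 1` (the tree's `atkinLehnerW (Mp²) (p²)`),
a direct matrix computation (`exists_twistT_mul_atkinLehnerW_eq`) gives, for `u ≢ 0 (mod p)`,

`[1, u/p; 0, 1] · w(p²) = (p · 1) · γ_u · [1, v/p; 0, 1]`,  `γ_u ∈ Γ₀(Mp)`,  `v ≡ −y²/u (mod p)`,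

so `(f ∣ [1,u/p;0,1]) ∣ w(p²) = p^{k−2} (f ∣ [1, v/p; 0, 1])` (`f` is `Γ₀(Mp)`-invariant and the scalar
matrix `p · 1` slashes by `p^{k−2}`); re-indexing the sum over `u` by the involution `u ↦ −y²/u` of
`ℤ/p` and using `χ(−y²/v) = χ(−1) χ(v)` (`χ` quadratic, `p ∤ y`) yields
`f_χ ∣ w(p²) = p^{k−2} χ(−1) f_χ` (`coe_twistRaw_slash_atkinLehnerW`), i.e.
`w_{p²} f_χ = (p²)^{1−k/2} p^{k−2} χ(−1) f_χ = χ(−1) f_χ` for Knapp's `det^{k/2}`-normalised involution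
`w_Q = Q^{1−k/2} [Γ₀ w(Q) Γ₀]` of the tree (`atkinLehnerInvolution`).

Everything here is proved; no named facts are introduced.

## References

* A. O. L. Atkin, J. Lehner, *Hecke operators on `Γ₀(m)`*, Math. Ann. 185 (1970), 134–160, §6.
* A. O. L. Atkin, W.-C. W. Li, *Twists of newforms and pseudo-eigenvalues of `W`-operators*,
  Invent. Math. 48 (1978), 221–243, §3.
* G. Shimura, *Introduction to the arithmetic theory of automorphic functions*, 1971, Prop. 3.64.
* D. Rohrlich, *Variation of the root number in families of elliptic curves*, Compositio Math. 87
  (1993), 119–151, Prop. 2.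
* A. W. Knapp, *Elliptic curves*, Math. Notes 40, Princeton UP 1993, Lemma 9.24, Thm. 9.27.
-/

noncomputable section

open scoped MatrixGroups ModularForm

open CongruenceSubgroup Matrix.SpecialLinearGroup Matrix.GeneralLinearGroup UpperHalfPlane Complex

namespace Literature.NumberTheory.EllipticCurves.ModularForms

/-! ### The Atkin–Lehner matrix `w(p²)` at level `Mp²` and its commutation with translations -/

section Matrices

variable {p : ℕ} [Fact p.Prime] {M : ℕ}

/-- `(M p²) / p² = M`. [folklore] -/
theorem mul_sq_div_sq : M * p ^ 2 / p ^ 2 = M :=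
  Nat.mul_div_cancel _ (pow_pos (Fact.out : p.Prime).pos 2)

/-- `p²` and `M = (Mp²)/p²` are coprime when `p ∤ M` (`p² ∥ Mp²`). [folklore] -/
theorem coprime_sq_div_of_not_dvd (hpM : ¬ p ∣ M) : Nat.Coprime (p ^ 2) (M * p ^ 2 / p ^ 2) := by
  rw [mul_sq_div_sq]
  exact Nat.Coprime.pow_left 2 ((Nat.Prime.coprime_iff_not_dvd Fact.out).mpr hpM)

/-- The entries of `β(p²) = (x y; M p²)` at level `Mp²`: second row `(M, p²)` and the Bézout relation
`p² x − M y = 1` (Knapp 1993, (9.62)). [cite: Knapp1993, (9.62)] -/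
theorem atkinLehnerSL_sq_entries (hpM : ¬ p ∣ M) :
    (atkinLehnerSL (M * p ^ 2) (p ^ 2)) 1 0 = (M : ℤ) ∧
      (atkinLehnerSL (M * p ^ 2) (p ^ 2)) 1 1 = ((p : ℤ) ^ 2) ∧
      ((p : ℤ) ^ 2) * (atkinLehnerSL (M * p ^ 2) (p ^ 2)) 0 0 -
        (M : ℤ) * (atkinLehnerSL (M * p ^ 2) (p ^ 2)) 0 1 = 1 := by
  have hc := coprime_sq_div_of_not_dvd (M := M) hpM
  obtain ⟨h10, h11⟩ := atkinLehnerSL_apply_one (M * p ^ 2) (p ^ 2) hc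
  have hb := atkinLehnerSL_bezout (M * p ^ 2) (p ^ 2) hc
  rw [mul_sq_div_sq] at h10 hb
  refine ⟨h10, by rw [h11]; push_cast; ring, ?_⟩
  push_cast at hb
  exact hb

/-- `p ∤ y` for the upper-right entry `y` of `β(p²)`: `My ≡ −1 (mod p)`. [folklore] -/
theorem natCast_mul_entry_eq_neg_one (hpM : ¬ p ∣ M) :
    (M : ZMod p) * (((atkinLehnerSL (M * p ^ 2) (p ^ 2)) 0 1 : ℤ) : ZMod p) = -1 := by
  obtain ⟨-, -, hb⟩ := atkinLehnerSL_sq_entries (M := M) hpM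
  have h := congrArg (fun z : ℤ ↦ (z : ZMod p)) hb
  push_cast at h
  rw [ZMod.natCast_self] at h
  linear_combination -h

/-- **Commutation of `w(p²)` with the translations** (the matrix identity behind Atkin–Lehner 1970,
§6 / Atkin–Li 1978, §3): for `u ≢ 0 (mod p)`, with `w(p²) = (p²x, y; Mp², p²)` and `v = −y²/u mod p`,
`[1, u/p; 0, 1] w(p²) = (p · 1) γ_u [1, v/p; 0, 1]` for an explicit `γ_u ∈ Γ₀(Mp)`, namely
`γ_u = (px + UM, t + U − xV; Mp, p − MV)` with `U = u.val`, `V = v.val`, `pt = y − UMV`. [folklore] -/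
theorem exists_twistT_mul_atkinLehnerW_eq [NeZero M] (hpM : ¬ p ∣ M) {u : ZMod p} (hu : u ≠ 0) :
    ∃ γ' ∈ Gamma0 (M * p),
      twistT u * glCast (atkinLehnerW (M * p ^ 2) (p ^ 2) : GL (Fin 2) ℚ) =
        tpD p * tpG p * (mapGL ℝ γ' : GL (Fin 2) ℝ) *
          twistT (-((((atkinLehnerSL (M * p ^ 2) (p ^ 2)) 0 1 : ℤ) : ZMod p)) ^ 2 * u⁻¹) := by
  haveI : NeZero p := ⟨(Fact.out : p.Prime).ne_zero⟩
  obtain ⟨h10, h11, hbez⟩ := atkinLehnerSL_sq_entries (M := M) hpM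
  have hMy := natCast_mul_entry_eq_neg_one (M := M) hpM
  set β := atkinLehnerSL (M * p ^ 2) (p ^ 2) with hβ
  set x := β 0 0 with hx
  set y := β 0 1 with hy
  set v : ZMod p := -((y : ZMod p)) ^ 2 * u⁻¹ with hv
  set U : ℤ := (u.val : ℤ) with hU
  set V : ℤ := (v.val : ℤ) with hV
  have hp0 : (p : ℝ) ≠ 0 := by exact_mod_cast NeZero.ne p
  -- `p ∣ y - U M V`
  have hdvd : (p : ℤ) ∣ y - U * M * V := by
    rw [← ZMod.intCast_zmod_eq_zero_iff_dvd]
    have hUc : ((U : ℤ) : ZMod p) = u := by simp [hU]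
    have hVc : ((V : ℤ) : ZMod p) = v := by simp [hV]
    push_cast
    rw [hUc, hVc, hv]
    have hu' : u * u⁻¹ = 1 := mul_inv_cancel₀ hu
    linear_combination (M : ZMod p) * (y : ZMod p) ^ 2 * hu' + (y : ZMod p) * hMy
  obtain ⟨t, ht⟩ := hdvd
  let A : Matrix (Fin 2) (Fin 2) ℤ := !![p * x + U * M, t + U - x * V; M * p, p - M * V]
  have hA : A.det = 1 := by
    rw [Matrix.det_fin_two_of]
    linear_combination hbez + (M : ℤ) * ht
  refine ⟨⟨A, hA⟩, ?_, ?_⟩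
  · rw [Gamma0_mem]
    simp only [A, Matrix.of_apply, Matrix.cons_val', Matrix.cons_val_zero, Matrix.cons_val_one,
      Matrix.cons_val_fin_one]
    rw [ZMod.intCast_zmod_eq_zero_iff_dvd]
    exact ⟨1, by push_cast; ring⟩
  · refine Units.ext ?_
    have hUr : ((u.val : ℕ) : ℝ) = (U : ℝ) := by rw [hU]; push_cast; rfl
    have hVr : ((v.val : ℕ) : ℝ) = (V : ℝ) := by rw [hV]; push_cast; rfl
    have h10r : ((β 1 0 : ℤ) : ℝ) = M := by exact_mod_cast h10
    have h11r : ((β 1 1 : ℤ) : ℝ) = (p : ℝ) ^ 2 := by exact_mod_cast h11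
    have htr : (y : ℝ) - U * M * V = p * t := by exact_mod_cast ht
    have hQ : (((p ^ 2 : ℕ) : ℝ)) = (p : ℝ) ^ 2 := by push_cast; ring
    have hβmap : ((β : Matrix (Fin 2) (Fin 2) ℤ).map fun z : ℤ ↦ (z : ℝ)) =
        !![(x : ℝ), (y : ℝ); (M : ℝ), (p : ℝ) ^ 2] := by
      ext i j
      fin_cases i <;> fin_cases j <;> simp [← hx, ← hy, h10r, h11r]
    have hAmap : (((⟨A, hA⟩ : SL(2, ℤ)) : Matrix (Fin 2) (Fin 2) ℤ).map fun z : ℤ ↦ (z : ℝ)) =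
        !![(p : ℝ) * x + U * M, (t : ℝ) + U - x * V; (M : ℝ) * p, (p : ℝ) - M * V] := by
      ext i j
      fin_cases i <;> fin_cases j <;> simp [A]
    rw [glCast_atkinLehnerW, ← hβ]
    simp only [Matrix.GeneralLinearGroup.coe_mul, val_twistT, val_mapGL', val_tpD, val_tpG, hβmap,
      hAmap, hUr, hVr, hQ]
    ext i j
    fin_cases i <;> fin_cases j <;> simp [Matrix.mul_apply, Fin.sum_univ_two] <;> field_simp <;>
      (first | ring1 | linear_combination htr)

end Matrices

/-! ### `f_χ ∣ w(p²) = p^{k-2} χ(-1) f_χ` -/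

section Slash

variable {p : ℕ} [Fact p.Prime] {M : ℕ} [NeZero M] {N : ℕ} [NeZero N] {k : ℤ}

omit [Fact p.Prime] [NeZero M] [NeZero N] in
/-- `N ∣ Mp²` from `N ∣ Mp`. [folklore] -/
theorem dvd_mul_sq_of_dvd_mul (hN : N ∣ M * p) : N ∣ M * p ^ 2 :=
  hN.trans ⟨p, by ring⟩

omit [Fact p.Prime] [NeZero M] in
/-- `p² ∣ Mp²`. [folklore] -/
theorem sq_dvd_mul_sq : p ^ 2 ∣ M * p ^ 2 := Dvd.intro_left M rfl

/-- **`(∑_u χ(u) f(· + u/p)) ∣ w(p²) = p^{k−2} χ(−1) ∑_u χ(u) f(· + u/p)`** for `f ∈ S_k(Γ₀(N))`,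
`N ∣ Mp`, `p ∤ M`, `χ` quadratic mod `p` (Atkin–Lehner 1970, §6; Atkin–Li 1978, §3; see the module
docstring for the computation). [folklore] -/
theorem coe_twistRaw_slash_atkinLehnerW (hpM : ¬ p ∣ M) (hN : N ∣ M * p) (f : CuspForm (Gamma0 N) k)
    {χ : DirichletCharacter ℂ p} (hχ : χ.IsQuadratic) :
    (⇑(twistRaw (M * p ^ 2) (dvd_mul_sq_of_dvd_mul hN) sq_dvd_mul_sq f χ) : ℍ → ℂ) ∣[k]
        glCast (atkinLehnerW (M * p ^ 2) (p ^ 2) : GL (Fin 2) ℚ) =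
      ((p : ℂ) ^ (k - 2) * χ (-1)) •
        (⇑(twistRaw (M * p ^ 2) (dvd_mul_sq_of_dvd_mul hN) sq_dvd_mul_sq f χ) : ℍ → ℂ) := by
  haveI : NeZero p := ⟨(Fact.out : p.Prime).ne_zero⟩
  have hMy := natCast_mul_entry_eq_neg_one (M := M) hpM
  have hy0 : ((((atkinLehnerSL (M * p ^ 2) (p ^ 2)) 0 1 : ℤ) : ZMod p)) ≠ 0 := by
    intro h
    rw [h, mul_zero] at hMy
    exact one_ne_zero (neg_eq_zero.mp hMy.symm)
  have hc0 : -((((atkinLehnerSL (M * p ^ 2) (p ^ 2)) 0 1 : ℤ) : ZMod p)) ^ 2 ≠ 0 := by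
    rw [neg_ne_zero]
    exact pow_ne_zero 2 hy0
  -- the re-indexing involution `u ↦ -y²/u` of `ZMod p`
  let e : ZMod p → ZMod p := fun u ↦ -((((atkinLehnerSL (M * p ^ 2) (p ^ 2)) 0 1 : ℤ) : ZMod p)) ^ 2 * u⁻¹
  have he : Function.Involutive e := by
    intro u
    simp only [e, mul_inv, inv_inv]
    rw [mul_inv_cancel_left₀ hc0]
  -- the pointwise identity
  have hσW : ∀ z, σ (glCast (atkinLehnerW (M * p ^ 2) (p ^ 2) : GL (Fin 2) ℚ)) z = z := σ_glCast _
  have key : ∀ u : ZMod p, (χ u • ((⇑f : ℍ → ℂ) ∣[k] twistT u)) ∣[k]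
      glCast (atkinLehnerW (M * p ^ 2) (p ^ 2) : GL (Fin 2) ℚ) =
      (χ u * (p : ℂ) ^ (k - 2)) • ((⇑f : ℍ → ℂ) ∣[k] twistT (e u)) := by
    intro u
    by_cases hu : u = 0
    · rw [hu, MulChar.map_zero, zero_mul, zero_smul, zero_smul, SlashAction.zero_slash]
    · obtain ⟨γ', hγ', hmat⟩ := exists_twistT_mul_atkinLehnerW_eq hpM hu
      have hmem : (mapGL ℝ γ' : GL (Fin 2) ℝ) ∈
          ((Gamma0 N : Subgroup SL(2, ℤ)) : Subgroup (GL (Fin 2) ℝ)) :=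
        ⟨γ', mem_Gamma0_of_entry_eq hN hγ' rfl, rfl⟩
      rw [ModularForm.smul_slash, hσW, ← SlashAction.slash_mul, hmat, SlashAction.slash_mul,
        SlashAction.slash_mul, slash_tpD_mul_tpG, ModularForm.smul_slash, σ_mapGL,
        SlashInvariantFormClass.slash_action_eq f _ hmem, ModularForm.smul_slash, σ_twistT,
        smul_smul]
  rw [coe_twistRaw, hχ.inv, finset_sum_slash]
  simp_rw [key]
  -- re-index by the involution `e`
  have hre : ∑ u : ZMod p, (χ u * (p : ℂ) ^ (k - 2)) • ((⇑f : ℍ → ℂ) ∣[k] twistT (e u)) =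
      ∑ w : ZMod p, (χ (e w) * (p : ℂ) ^ (k - 2)) • ((⇑f : ℍ → ℂ) ∣[k] twistT w) := by
    rw [← Equiv.sum_comp (he.toPerm e) (fun w : ZMod p ↦
      (χ (e w) * (p : ℂ) ^ (k - 2)) • ((⇑f : ℍ → ℂ) ∣[k] twistT w))]
    refine Finset.sum_congr rfl fun u _ ↦ ?_
    simp only [Function.Involutive.coe_toPerm, he u]
  rw [hre, Finset.smul_sum]
  refine Finset.sum_congr rfl fun w _ ↦ ?_
  have hχe : χ (e w) = χ (-1) * χ w := by
    have hsq : χ ((((atkinLehnerSL (M * p ^ 2) (p ^ 2)) 0 1 : ℤ) : ZMod p)) ^ 2 = 1 :=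
      apply_sq_eq_one_of_isQuadratic hχ (isUnit_iff_ne_zero.mpr hy0)
    simp only [e]
    rw [neg_eq_neg_one_mul, map_mul, map_mul, map_pow, hsq, mul_one, ← MulChar.inv_apply', hχ.inv]
  rw [hχe, smul_smul]
  congr 1
  ring

/-- The normalisation constant of `w_{p²}` cancels the scalar slash factor:
`(p²)^{1−k/2} · p^{k−2} = 1`. [folklore] -/
theorem rpow_sq_mul_zpow_eq_one (k : ℤ) :
    ((((p ^ 2 : ℕ) : ℝ) ^ (1 - (k : ℝ) / 2) : ℝ) : ℂ) * (p : ℂ) ^ (k - 2) = 1 := by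
  have hp0 : (0 : ℝ) ≤ p := Nat.cast_nonneg p
  have h1 : (((p ^ 2 : ℕ) : ℝ) ^ (1 - (k : ℝ) / 2) : ℝ) = (p : ℝ) ^ ((2 - k : ℤ)) := by
    rw [Nat.cast_pow, ← Real.rpow_natCast (p : ℝ) 2, ← Real.rpow_mul hp0, ← Real.rpow_intCast]
    congr 1
    push_cast
    ring
  rw [h1]
  push_cast
  rw [← zpow_add₀ (by exact_mod_cast (Fact.out : p.Prime).ne_zero : (p : ℂ) ≠ 0)]
  norm_num

/-- **`w_{p²} f_χ = χ(−1) f_χ`**: the twist of `f ∈ S_k(Γ₀(N))`, `N ∣ Mp`, `p ∤ M`, by a quadratic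
character `χ mod p` is an eigenvector of the Atkin–Lehner involution `w_{p²}` of `S_k(Γ₀(Mp²))`
(Knapp's normalisation, `atkinLehnerInvolution`) with eigenvalue `χ(−1)` (Atkin–Lehner 1970, §6;
Atkin–Li 1978, §3). [folklore] -/
theorem atkinLehnerInvolution_charTwist (hpM : ¬ p ∣ M) (hN : N ∣ M * p) {χ : DirichletCharacter ℂ p}
    (hχ : χ.IsQuadratic) (f : CuspForm (Gamma0 N) k) :
    atkinLehnerInvolution (M * p ^ 2) k (p ^ 2)
        (charTwist (M * p ^ 2) (dvd_mul_sq_of_dvd_mul hN) sq_dvd_mul_sq hχ f) =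
      χ (-1) • charTwist (M * p ^ 2) (dvd_mul_sq_of_dvd_mul hN) sq_dvd_mul_sq hχ f := by
  apply DFunLike.coe_injective
  rw [atkinLehnerInvolution_apply_eq_slash (M * p ^ 2) k (p ^ 2) sq_dvd_mul_sq
      (coprime_sq_div_of_not_dvd hpM), coe_charTwist, ModularForm.smul_slash, σ_glCast,
    coe_twistRaw_slash_atkinLehnerW hpM hN f hχ, CuspForm.IsGLPos.coe_smul, coe_charTwist, smul_smul,
    smul_smul, smul_smul]
  congr 1
  linear_combination ((gaussSum χ⁻¹ (ZMod.stdAddChar (N := p)))⁻¹ * χ (-1)) *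
    rpow_sq_mul_zpow_eq_one (p := p) k

/-- `v_p(Mp²) = 2` for `p ∤ M`, i.e. `Q_p = p²` at level `Mp²`. [folklore] -/
theorem pow_factorization_mul_sq (hpM : ¬ p ∣ M) : p ^ (M * p ^ 2).factorization p = p ^ 2 := by
  have hp : p.Prime := Fact.out
  congr 1
  rw [Nat.factorization_mul (NeZero.ne M) (pow_ne_zero 2 hp.ne_zero), Finsupp.add_apply,
    Nat.factorization_eq_zero_of_not_dvd hpM, hp.factorization_pow, Finsupp.single_eq_same, zero_add]

/-- **`w_{Q_p} f_χ = χ(−1) f_χ` at level `Mp²`** (`Q_p = p²`): the `At p` form of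
`atkinLehnerInvolution_charTwist`. [folklore] -/
theorem atkinLehnerInvolutionAt_charTwist (hpM : ¬ p ∣ M) (hN : N ∣ M * p)
    {χ : DirichletCharacter ℂ p} (hχ : χ.IsQuadratic) (f : CuspForm (Gamma0 N) k) :
    atkinLehnerInvolutionAt (M * p ^ 2) k p
        (charTwist (M * p ^ 2) (dvd_mul_sq_of_dvd_mul hN) sq_dvd_mul_sq hχ f) =
      χ (-1) • charTwist (M * p ^ 2) (dvd_mul_sq_of_dvd_mul hN) sq_dvd_mul_sq hχ f := by
  rw [atkinLehnerInvolutionAt_eq (pow_factorization_mul_sq (M := M) hpM)]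
  exact atkinLehnerInvolution_charTwist hpM hN hχ f

/-- **The Atkin–Lehner eigenvalue at `p` of a non-zero quadratic twist is `χ(−1)`**:
`λ_p(f_χ) = χ(−1)` for `f_χ ≠ 0` (e.g. `χ` primitive and `a₁(f) ≠ 0`, `charTwist_ne_zero`)
(Atkin–Lehner 1970, §6; Atkin–Li 1978, §3). For `χ = (·/p)` this is `(−1/p)`, Rohrlich's local
root number `W_p` of a quadratic twist by `ℚ(√±p)` of a curve semistable at `p` (Rohrlich 1993,
Prop. 2). [folklore] -/
theorem atkinLehnerEigenvalueAt_charTwist (hpM : ¬ p ∣ M) (hN : N ∣ M * p)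
    {χ : DirichletCharacter ℂ p} (hχ : χ.IsQuadratic) {f : CuspForm (Gamma0 N) k}
    (hf : charTwist (M * p ^ 2) (dvd_mul_sq_of_dvd_mul hN) sq_dvd_mul_sq hχ f ≠ 0) :
    atkinLehnerEigenvalueAt (charTwist (M * p ^ 2) (dvd_mul_sq_of_dvd_mul hN) sq_dvd_mul_sq hχ f) p =
      χ (-1) :=
  atkinLehnerEigenvalueAt_eq_of_eq_smul hf (atkinLehnerInvolutionAt_charTwist hpM hN hχ f)

/-- The eigenvalue statement for a primitive quadratic `χ` and `f` with `a₁(f) ≠ 0` (e.g. a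
normalised eigenform): `λ_p(f_χ) = χ(−1)`. [folklore] -/
theorem atkinLehnerEigenvalueAt_charTwist_of_isPrimitive (hpM : ¬ p ∣ M) (hN : N ∣ M * p)
    {χ : DirichletCharacter ℂ p} (hχ : χ.IsQuadratic) (hprim : χ.IsPrimitive)
    {f : CuspForm (Gamma0 N) k} (hf : cuspCoeff f 1 ≠ 0) :
    atkinLehnerEigenvalueAt (charTwist (M * p ^ 2) (dvd_mul_sq_of_dvd_mul hN) sq_dvd_mul_sq hχ f) p =
      χ (-1) :=
  atkinLehnerEigenvalueAt_charTwist hpM hN hχ (charTwist_ne_zero _ _ _ hχ hprim hf)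

end Slash

/-! ### The same statements at a level `L = Mp²` given propositionally

For the application to the newform of an elliptic curve the level is the conductor `N_E`, equal
but not syntactically identical to `M p²`; the following versions take `hL : L = M * p ^ 2`. -/

section Level

variable {p : ℕ} [Fact p.Prime] {M : ℕ} [NeZero M] {N : ℕ} [NeZero N] {k : ℤ} {L : ℕ} [NeZero L]

/-- `w_{Q_p} f_χ = χ(−1) f_χ` at a level `L = Mp²` (`atkinLehnerInvolutionAt_charTwist` transported
along `hL`). [folklore] -/
theorem atkinLehnerInvolutionAt_charTwist_of_eq (hL : L = M * p ^ 2) (hpM : ¬ p ∣ M)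
    (hN : N ∣ M * p) (hNL : N ∣ L) (hpL : p ^ 2 ∣ L) {χ : DirichletCharacter ℂ p}
    (hχ : χ.IsQuadratic) (f : CuspForm (Gamma0 N) k) :
    atkinLehnerInvolutionAt L k p (charTwist L hNL hpL hχ f) = χ (-1) • charTwist L hNL hpL hχ f := by
  subst hL
  exact atkinLehnerInvolutionAt_charTwist hpM hN hχ f

/-- `λ_p(f_χ) = χ(−1)` at a level `L = Mp²`, for `f_χ ≠ 0`. [folklore] -/
theorem atkinLehnerEigenvalueAt_charTwist_of_eq (hL : L = M * p ^ 2) (hpM : ¬ p ∣ M)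
    (hN : N ∣ M * p) (hNL : N ∣ L) (hpL : p ^ 2 ∣ L) {χ : DirichletCharacter ℂ p}
    (hχ : χ.IsQuadratic) {f : CuspForm (Gamma0 N) k} (hf : charTwist L hNL hpL hχ f ≠ 0) :
    atkinLehnerEigenvalueAt (charTwist L hNL hpL hχ f) p = χ (-1) :=
  atkinLehnerEigenvalueAt_eq_of_eq_smul hf
    (atkinLehnerInvolutionAt_charTwist_of_eq hL hpM hN hNL hpL hχ f)

/-- `λ_p(f_χ) = χ(−1)` at a level `L = Mp²`, for a primitive quadratic `χ` and `a₁(f) ≠ 0`.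
[folklore] -/
theorem atkinLehnerEigenvalueAt_charTwist_of_eq_of_isPrimitive (hL : L = M * p ^ 2) (hpM : ¬ p ∣ M)
    (hN : N ∣ M * p) (hNL : N ∣ L) (hpL : p ^ 2 ∣ L) {χ : DirichletCharacter ℂ p}
    (hχ : χ.IsQuadratic) (hprim : χ.IsPrimitive) {f : CuspForm (Gamma0 N) k}
    (hf : cuspCoeff f 1 ≠ 0) :
    atkinLehnerEigenvalueAt (charTwist L hNL hpL hχ f) p = χ (-1) :=
  atkinLehnerEigenvalueAt_charTwist_of_eq hL hpM hN hNL hpL hχ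
    (charTwist_ne_zero _ _ _ hχ hprim hf)

end Level

end Literature.NumberTheory.EllipticCurves.ModularForms

end
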